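import Mathlib
import HarnessLib
import Literature.MathematicalPhysics.QuantumLattice.HubbardUVSymbolResummedLipschitz
import Literature.MathematicalPhysics.QuantumLattice.HubbardUVSymbolCTDifferences
import Summits.HubbardSuperconductivity.HubbardSuperconductivity.Theorems.KLProgrammeKLRegimeSplitFrameDist
import Summits.HubbardSuperconductivity.HubbardSuperconductivity.Theorems.KLProgrammeKLRegimeEngineCovarianceResponseAtPoint

/-!
# K3 ENGINE child (stmt-HubbardSuperconductivity-20236 `KLRegimeEngineV16`), stub `stub_twoLeg_scale0` (E3c-TD)₀: the model's RESUMMED symbol is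
# `uvResummedFn` at `(βL², Λ, ω_i, ξ(k⃗), K(p_k⃗))`, and its two-frame response is Lipschitz in `frameDist`

Cell gate-hubbard-kl, seat p2 (g10).  Bridge from the generic `Literature/…/HubbardUVSymbolResummedLipschitz` (p519430) to k3c5-p1's resummed
representation (`klSelfEnergy_eq_chain_add_resummed`: `Σ^res = selfEnergy (effAction (normalCovariance Ψ̃) V_U)`, `Ψ̃ = Ψ/(1 + Ψ·K(p)/(βL²))`,
`Ψ = uvSymbolCT … K Λ`) and to the covariance-response door `covResp_norm_selfEnergy_sub_le` (p515302, symbols `s_i := Ψ̃_{K_i}`):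

* `resummedSymbolCT_eq_uvResummedFn` — `Ψ̃_K((i,k⃗),σ) = uvResummedFn (βL²) Λ ω_i ξ(k⃗) (K(p_k⃗))` (`ξ = nambuXi = ε − μ`, `e_K = ξ − K(p)`);
* **`norm_resummedSymbolCT_sub_le`** — for `0 < β`, `0 < Λ`, `|K(p_k⃗)|, |K′(p_k⃗)| ≤ Λ/4`:
  `‖Ψ̃_K − Ψ̃_{K′}‖((i,k⃗),σ) ≤ βL²·(200 + 200B₁)/Λ²·|K(p_k⃗) − K′(p_k⃗)| ≤ βL²·(200 + 200B₁)/Λ²·frameDist K K′`;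
* `resummedSymbolCT_sub_eq_zero_of_ge` / `…_eq_zero_of_le` — the difference VANISHES where both frames are above the shell (in particular
  at every frequency `|ω_i| ≥ Λ`) and each symbol vanishes below its shell;
* **`sum_norm_resummedSymbolCT_sub_le`** — `Σ_{ks} ‖Ψ̃_K − Ψ̃_{K′}‖(ks) ≤ #{ks : |ω| < Λ} · βL²(200+200B₁)/Λ² · frameDist K K′`, with
  `card_freqWindow_eq`: `#{ks : |ω| < Λ} = #{i : |ω_i| < Λ} · L² · 2`;
* **`covResp_norm_selfEnergy_resummed_sub_le`** — the COMPOSED DOOR: plugging these into `covResp_norm_selfEnergy_sub_le` (p515302),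
  `‖Σ[𝒢(C̃_{K₁})] − Σ[𝒢(C̃_{K₀})]‖(k,σ) ≤ 2βL²·(12·#{…}·c_Λ·frameDist K₁ K₀·N + 2·c_Λ·frameDist K₁ K₀·S²)`, `c_Λ = βL²(200+200B₁)/Λ²`,
  under the door's hypotheses (`Z_t ≠ 0`, four-leg bound `N`, two-leg bound `S` along the interpolation) and `|K_i(p_k⃗)| ≤ Λ/4`.

Proofs only; the sizes `N`, `S`, `B₁` and the window count are hypotheses/explicit, nothing about their values is asserted.
-/

noncomputable section

namespace Summit.HubbardSuperconductivity.HubbardSuperconductivity.Theorems.EngineV8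

set_option linter.dupNamespace false -- summit = problem name (single-conjunct summit), D-0017

open Literature.MathematicalPhysics.QuantumLattice Literature.Probability.LatticeModels
open Summit.HubbardSuperconductivity.HubbardSuperconductivity.Theorems.KLRegimeSplit

variable {L M : ℕ} [NeZero L]

/-- **The model's resummed symbol is `uvResummedFn`** at `c = βL²`, frequency `ω_i`, free band value `ξ(k⃗) = ε(k⃗) − μ` and frame value `K(p_k⃗)`. -/
theorem resummedSymbolCT_eq_uvResummedFn {β : ℝ} (hβ : 0 < β) (μ : ℝ) (K : TrigPolyC4v) (Λ : ℝ) (i : MatsubaraIdx M)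
    (kv : TorusSite 2 L) (σ : Fin 2) :
    uvSymbolCT L M β μ K Λ ((i, kv), σ) /
        (1 + uvSymbolCT L M β μ K Λ ((i, kv), σ) * ((K.eval (latticeMomentum L kv) / (β * (L : ℝ) ^ 2) : ℝ) : ℂ)) =
      uvResummedFn (β * (L : ℝ) ^ 2) Λ (matsubaraFreq β M i) (nambuXi L μ kv) (K.eval (latticeMomentum L kv)) := by
  rw [uvResummedFn, uvSymbolCT_eq_uvSymbolFn hβ, nambuXi_eq_nambuXiCT_add L μ K kv, add_sub_cancel_right]

/-- **Two-frame response of the resummed symbol, pointwise in `K(p_k⃗)`**: for `|K(p_k⃗)|, |K′(p_k⃗)| ≤ Λ/4`,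
`‖Ψ̃_K − Ψ̃_{K′}‖ ≤ βL²(200+200B₁)/Λ²·|K(p_k⃗) − K′(p_k⃗)|`. -/
theorem norm_resummedSymbolCT_sub_le_abs {B₁ : ℝ} (hB0 : 0 ≤ B₁) (hB : ∀ y, |deriv salmhoferCutoff y| ≤ B₁) {β : ℝ} (hβ : 0 < β)
    {Λ : ℝ} (hΛ : 0 < Λ) (μ : ℝ) {K K' : TrigPolyC4v} (i : MatsubaraIdx M) (kv : TorusSite 2 L) (σ : Fin 2)
    (hK : |K.eval (latticeMomentum L kv)| ≤ Λ / 4) (hK' : |K'.eval (latticeMomentum L kv)| ≤ Λ / 4) :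
    ‖uvSymbolCT L M β μ K Λ ((i, kv), σ) /
          (1 + uvSymbolCT L M β μ K Λ ((i, kv), σ) * ((K.eval (latticeMomentum L kv) / (β * (L : ℝ) ^ 2) : ℝ) : ℂ)) -
        uvSymbolCT L M β μ K' Λ ((i, kv), σ) /
          (1 + uvSymbolCT L M β μ K' Λ ((i, kv), σ) * ((K'.eval (latticeMomentum L kv) / (β * (L : ℝ) ^ 2) : ℝ) : ℂ))‖ ≤
      β * (L : ℝ) ^ 2 * (200 + 200 * B₁) / Λ ^ 2 * |K.eval (latticeMomentum L kv) - K'.eval (latticeMomentum L kv)| := by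
  have hL : (0 : ℝ) < L := by exact_mod_cast NeZero.pos L
  rw [resummedSymbolCT_eq_uvResummedFn hβ, resummedSymbolCT_eq_uvResummedFn hβ]
  exact norm_uvResummedFn_sub_le hB0 hB (by positivity) hΛ (matsubaraFreq_ne_zero hβ.ne' i) _ hK hK'

/-- **Two-frame response of the resummed symbol in `frameDist`**: `‖Ψ̃_K − Ψ̃_{K′}‖ ≤ βL²(200+200B₁)/Λ²·frameDist K K′`. -/
theorem norm_resummedSymbolCT_sub_le {B₁ : ℝ} (hB0 : 0 ≤ B₁) (hB : ∀ y, |deriv salmhoferCutoff y| ≤ B₁) {β : ℝ} (hβ : 0 < β)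
    {Λ : ℝ} (hΛ : 0 < Λ) (μ : ℝ) {K K' : TrigPolyC4v} (i : MatsubaraIdx M) (kv : TorusSite 2 L) (σ : Fin 2)
    (hK : |K.eval (latticeMomentum L kv)| ≤ Λ / 4) (hK' : |K'.eval (latticeMomentum L kv)| ≤ Λ / 4) :
    ‖uvSymbolCT L M β μ K Λ ((i, kv), σ) /
          (1 + uvSymbolCT L M β μ K Λ ((i, kv), σ) * ((K.eval (latticeMomentum L kv) / (β * (L : ℝ) ^ 2) : ℝ) : ℂ)) -
        uvSymbolCT L M β μ K' Λ ((i, kv), σ) /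
          (1 + uvSymbolCT L M β μ K' Λ ((i, kv), σ) * ((K'.eval (latticeMomentum L kv) / (β * (L : ℝ) ^ 2) : ℝ) : ℂ))‖ ≤
      β * (L : ℝ) ^ 2 * (200 + 200 * B₁) / Λ ^ 2 * frameDist K K' := by
  have hL : (0 : ℝ) < L := by exact_mod_cast NeZero.pos L
  refine (norm_resummedSymbolCT_sub_le_abs hB0 hB hβ hΛ μ i kv σ hK hK').trans ?_
  have hc : 0 ≤ β * (L : ℝ) ^ 2 * (200 + 200 * B₁) / Λ ^ 2 := by positivity
  exact mul_le_mul_of_nonneg_left (abs_eval_sub_le_frameDist K K' _) hc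

/-- The resummed symbol of a frame VANISHES below that frame's shell (`ω_i² + e_K(k⃗)² ≤ Λ²/4`). -/
theorem resummedSymbolCT_eq_zero_of_le {β : ℝ} (hβ : 0 < β) {Λ : ℝ} (hΛ : 0 < Λ) (μ : ℝ) (K : TrigPolyC4v) (i : MatsubaraIdx M)
    (kv : TorusSite 2 L) (σ : Fin 2) (h : matsubaraFreq β M i ^ 2 + nambuXiCT L μ K kv ^ 2 ≤ Λ ^ 2 / 4) :
    uvSymbolCT L M β μ K Λ ((i, kv), σ) /
        (1 + uvSymbolCT L M β μ K Λ ((i, kv), σ) * ((K.eval (latticeMomentum L kv) / (β * (L : ℝ) ^ 2) : ℝ) : ℂ)) = 0 := by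
  have hL : (0 : ℝ) < L := by exact_mod_cast NeZero.pos L
  rw [resummedSymbolCT_eq_uvResummedFn hβ]
  refine uvResummedFn_eq_zero_of_weight (by positivity) (matsubaraFreq_ne_zero hβ.ne' i) (uvWeightFn_eq_zero_of_le hΛ ?_)
  rwa [nambuXi_eq_nambuXiCT_add L μ K kv, add_sub_cancel_right]

/-- **Both frames above their shells ⇒ same resummed symbol** (`ω_i² + e_K² ≥ Λ²` and `ω_i² + e_{K′}² ≥ Λ²`): the response is supported on the
bounded window where at least one frame is inside its shell. -/
theorem resummedSymbolCT_sub_eq_zero_of_ge {β : ℝ} (hβ : 0 < β) {Λ : ℝ} (hΛ : 0 < Λ) (μ : ℝ) (K K' : TrigPolyC4v) (i : MatsubaraIdx M)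
    (kv : TorusSite 2 L) (σ : Fin 2) (h : Λ ^ 2 ≤ matsubaraFreq β M i ^ 2 + nambuXiCT L μ K kv ^ 2)
    (h' : Λ ^ 2 ≤ matsubaraFreq β M i ^ 2 + nambuXiCT L μ K' kv ^ 2) :
    uvSymbolCT L M β μ K Λ ((i, kv), σ) /
          (1 + uvSymbolCT L M β μ K Λ ((i, kv), σ) * ((K.eval (latticeMomentum L kv) / (β * (L : ℝ) ^ 2) : ℝ) : ℂ)) -
        uvSymbolCT L M β μ K' Λ ((i, kv), σ) /
          (1 + uvSymbolCT L M β μ K' Λ ((i, kv), σ) * ((K'.eval (latticeMomentum L kv) / (β * (L : ℝ) ^ 2) : ℝ) : ℂ)) = 0 := by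
  have hL : (0 : ℝ) < L := by exact_mod_cast NeZero.pos L
  rw [resummedSymbolCT_eq_uvResummedFn hβ, resummedSymbolCT_eq_uvResummedFn hβ]
  refine uvResummedFn_sub_eq_zero_of_weights_one (by positivity) (matsubaraFreq_ne_zero hβ.ne' i)
    (uvWeightFn_eq_one_of_ge hΛ ?_) (uvWeightFn_eq_one_of_ge hΛ ?_)
  · rwa [nambuXi_eq_nambuXiCT_add L μ K kv, add_sub_cancel_right]
  · rwa [nambuXi_eq_nambuXiCT_add L μ K' kv, add_sub_cancel_right]

/-- **Window factorisation**: `#{ks = ((i,k⃗),σ) : |ω_i| < Λ} = #{i : |ω_i| < Λ} · L² · 2`. -/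
theorem card_freqWindow_eq (β Λ : ℝ) :
    (Finset.univ.filter fun ks : FreqMomentum L M × Fin 2 => |matsubaraFreq β M ks.1.1| < Λ).card =
      (Finset.univ.filter fun i : MatsubaraIdx M => |matsubaraFreq β M i| < Λ).card * L ^ 2 * 2 := by
  classical
  have h : (Finset.univ.filter fun ks : FreqMomentum L M × Fin 2 => |matsubaraFreq β M ks.1.1| < Λ) =
      ((Finset.univ.filter fun i : MatsubaraIdx M => |matsubaraFreq β M i| < Λ) ×ˢ (Finset.univ : Finset (TorusSite 2 L))) ×ˢ
        (Finset.univ : Finset (Fin 2)) := by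
    ext ⟨⟨i, kv⟩, σ⟩
    simp
  rw [h, Finset.card_product, Finset.card_product, Finset.card_univ, Finset.card_univ, Fintype.card_fin]
  simp [TorusSite, ZMod.card]

/-- **ℓ¹ two-frame response of the resummed symbol**: for `0 < β`, `0 < Λ`, `|K(p)|, |K′(p)| ≤ Λ/4` at every lattice momentum,
`Σ_{ks} ‖Ψ̃_K(ks) − Ψ̃_{K′}(ks)‖ ≤ #{ks : |ω| < Λ} · βL²(200+200B₁)/Λ² · frameDist K K′` (outside the frequency window both frames are
above their shells and the terms vanish). -/
theorem sum_norm_resummedSymbolCT_sub_le {B₁ : ℝ} (hB0 : 0 ≤ B₁) (hB : ∀ y, |deriv salmhoferCutoff y| ≤ B₁) {β : ℝ} (hβ : 0 < β)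
    {Λ : ℝ} (hΛ : 0 < Λ) (μ : ℝ) {K K' : TrigPolyC4v} (hK : ∀ kv : TorusSite 2 L, |K.eval (latticeMomentum L kv)| ≤ Λ / 4)
    (hK' : ∀ kv : TorusSite 2 L, |K'.eval (latticeMomentum L kv)| ≤ Λ / 4) :
    ∑ ks : FreqMomentum L M × Fin 2,
        ‖uvSymbolCT L M β μ K Λ ks /
              (1 + uvSymbolCT L M β μ K Λ ks * ((K.eval (latticeMomentum L ks.1.2) / (β * (L : ℝ) ^ 2) : ℝ) : ℂ)) -
            uvSymbolCT L M β μ K' Λ ks /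
              (1 + uvSymbolCT L M β μ K' Λ ks * ((K'.eval (latticeMomentum L ks.1.2) / (β * (L : ℝ) ^ 2) : ℝ) : ℂ))‖ ≤
      ((Finset.univ.filter fun ks : FreqMomentum L M × Fin 2 => |matsubaraFreq β M ks.1.1| < Λ).card : ℝ) *
        (β * (L : ℝ) ^ 2 * (200 + 200 * B₁) / Λ ^ 2 * frameDist K K') := by
  classical
  have hL : (0 : ℝ) < L := by exact_mod_cast NeZero.pos L
  have hC : 0 ≤ β * (L : ℝ) ^ 2 * (200 + 200 * B₁) / Λ ^ 2 * frameDist K K' :=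
    mul_nonneg (by positivity) (frameDist_nonneg K K')
  calc ∑ ks : FreqMomentum L M × Fin 2,
        ‖uvSymbolCT L M β μ K Λ ks /
              (1 + uvSymbolCT L M β μ K Λ ks * ((K.eval (latticeMomentum L ks.1.2) / (β * (L : ℝ) ^ 2) : ℝ) : ℂ)) -
            uvSymbolCT L M β μ K' Λ ks /
              (1 + uvSymbolCT L M β μ K' Λ ks * ((K'.eval (latticeMomentum L ks.1.2) / (β * (L : ℝ) ^ 2) : ℝ) : ℂ))‖
      ≤ ∑ ks : FreqMomentum L M × Fin 2,
          (if |matsubaraFreq β M ks.1.1| < Λ then β * (L : ℝ) ^ 2 * (200 + 200 * B₁) / Λ ^ 2 * frameDist K K' else 0) := by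
        refine Finset.sum_le_sum fun ks _ => ?_
        obtain ⟨⟨i, kv⟩, σ⟩ := ks
        dsimp only
        split_ifs with h
        · exact norm_resummedSymbolCT_sub_le hB0 hB hβ hΛ μ i kv σ (hK kv) (hK' kv)
        · have hΛω : Λ ^ 2 ≤ matsubaraFreq β M i ^ 2 := by
            have h1 : Λ ≤ |matsubaraFreq β M i| := not_lt.1 h
            calc Λ ^ 2 ≤ |matsubaraFreq β M i| ^ 2 := by gcongr
              _ = matsubaraFreq β M i ^ 2 := sq_abs _
          rw [resummedSymbolCT_sub_eq_zero_of_ge hβ hΛ μ K K' i kv σ (hΛω.trans (le_add_of_nonneg_right (sq_nonneg _)))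
            (hΛω.trans (le_add_of_nonneg_right (sq_nonneg _))), norm_zero]
    _ = ((Finset.univ.filter fun ks : FreqMomentum L M × Fin 2 => |matsubaraFreq β M ks.1.1| < Λ).card : ℝ) *
          (β * (L : ℝ) ^ 2 * (200 + 200 * B₁) / Λ ^ 2 * frameDist K K') := by
        rw [Finset.sum_ite, Finset.sum_const_zero, add_zero, Finset.sum_const, nsmul_eq_mul]

/-- **The composed door — covariance response of the RESUMMED two-leg kernel to a frame shift.**  With `s_i = Ψ̃_{K_i}` the resummed
symbols of two frames `|K_i(p_k⃗)| ≤ Λ/4`, and the hypotheses of `covResp_norm_selfEnergy_sub_le` along the interpolation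
`C_t = C̃_{K₀} + t(C̃_{K₁} − C̃_{K₀})` (`Z_t ≠ 0`, four-leg kernels at the reading point `≤ N`, the two-leg kernel `≤ S`):
`‖Σ[𝒢(C̃_{K₁},V_U)] − Σ[𝒢(C̃_{K₀},V_U)]‖(k,σ) ≤ 2|β|L²·(12·(#{ks : |ω| < Λ}·c_Λ·frameDist K₁ K₀)·N + 2·(c_Λ·frameDist K₁ K₀)·S²)`,
`c_Λ = βL²(200+200B₁)/Λ²` — LINEAR in `frameDist K₁ K₀`, no position moments of the covariance. -/
theorem covResp_norm_selfEnergy_resummed_sub_le {B₁ : ℝ} (hB0 : 0 ≤ B₁) (hB : ∀ y, |deriv salmhoferCutoff y| ≤ B₁) {β : ℝ} (hβ : 0 < β)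
    {Λ : ℝ} (hΛ : 0 < Λ) (μ U : ℝ) {K₀ K₁ : TrigPolyC4v} (hK₀ : ∀ kv : TorusSite 2 L, |K₀.eval (latticeMomentum L kv)| ≤ Λ / 4)
    (hK₁ : ∀ kv : TorusSite 2 L, |K₁.eval (latticeMomentum L kv)| ≤ Λ / 4) {s₀ s₁ : FreqMomentum L M × Fin 2 → ℂ}
    (hs₀ : s₀ = fun ks => uvSymbolCT L M β μ K₀ Λ ks /
      (1 + uvSymbolCT L M β μ K₀ Λ ks * ((K₀.eval (latticeMomentum L ks.1.2) / (β * (L : ℝ) ^ 2) : ℝ) : ℂ)))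
    (hs₁ : s₁ = fun ks => uvSymbolCT L M β μ K₁ Λ ks /
      (1 + uvSymbolCT L M β μ K₁ Λ ks * ((K₁.eval (latticeMomentum L ks.1.2) / (β * (L : ℝ) ^ 2) : ℝ) : ℂ)))
    (k : FreqMomentum L M) (σ : Fin 2)
    (hZ : ∀ t ∈ Set.Icc (0 : ℝ) 1, effPartitionFn ℂ (normalCovariance L M s₀ + ((t : ℂ)) • (normalCovariance L M s₁ - normalCovariance L M s₀))
      (hubbardInteraction L M β U) ≠ 0)
    {N S : ℝ}
    (hN : ∀ t ∈ Set.Icc (0 : ℝ) 1, ∀ A : HubbardFieldIdx L M,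
      ‖kernel ℂ (effAction ℂ (normalCovariance L M s₀ + ((t : ℂ)) • (normalCovariance L M s₁ - normalCovariance L M s₀))
        (hubbardInteraction L M β U)) 4
        (Fin.snoc (Fin.snoc ![(((k, σ), 0) : HubbardFieldIdx L M), ((k, σ), 1)] ((A.1, 1 - A.2)) : Fin 3 → HubbardFieldIdx L M) A)‖ ≤ N)
    (hS : ∀ t ∈ Set.Icc (0 : ℝ) 1,
      ‖kernel ℂ (effAction ℂ (normalCovariance L M s₀ + ((t : ℂ)) • (normalCovariance L M s₁ - normalCovariance L M s₀))
        (hubbardInteraction L M β U)) 2 ![(((k, σ), 0) : HubbardFieldIdx L M), ((k, σ), 1)]‖ ≤ S) :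
    ‖selfEnergy L M β (effAction ℂ (normalCovariance L M s₁) (hubbardInteraction L M β U)) k σ -
        selfEnergy L M β (effAction ℂ (normalCovariance L M s₀) (hubbardInteraction L M β U)) k σ‖ ≤
      2 * (|β| * (L : ℝ) ^ 2) *
        (12 * (((Finset.univ.filter fun ks : FreqMomentum L M × Fin 2 => |matsubaraFreq β M ks.1.1| < Λ).card : ℝ) *
              (β * (L : ℝ) ^ 2 * (200 + 200 * B₁) / Λ ^ 2 * frameDist K₁ K₀)) * N +
          2 * (β * (L : ℝ) ^ 2 * (200 + 200 * B₁) / Λ ^ 2 * frameDist K₁ K₀) * S ^ 2) := by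
  have h := covResp_norm_selfEnergy_sub_le s₀ s₁ β U k σ hZ hN hS
  refine h.trans ?_
  have hN0 : 0 ≤ N := (norm_nonneg _).trans (hN 0 ⟨le_rfl, zero_le_one⟩ ((k, σ), 0))
  have h1 : ∑ p, ‖s₁ p - s₀ p‖ ≤
      ((Finset.univ.filter fun ks : FreqMomentum L M × Fin 2 => |matsubaraFreq β M ks.1.1| < Λ).card : ℝ) *
        (β * (L : ℝ) ^ 2 * (200 + 200 * B₁) / Λ ^ 2 * frameDist K₁ K₀) := by
    subst hs₀ hs₁
    exact sum_norm_resummedSymbolCT_sub_le hB0 hB hβ hΛ μ hK₁ hK₀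
  have h2 : ‖s₁ (k, σ) - s₀ (k, σ)‖ ≤ β * (L : ℝ) ^ 2 * (200 + 200 * B₁) / Λ ^ 2 * frameDist K₁ K₀ := by
    subst hs₀ hs₁
    obtain ⟨i, kv⟩ := k
    exact norm_resummedSymbolCT_sub_le hB0 hB hβ hΛ μ i kv σ (hK₁ kv) (hK₀ kv)
  have hβ' : 0 ≤ 2 * (|β| * (L : ℝ) ^ 2) := by positivity
  refine mul_le_mul_of_nonneg_left (add_le_add ?_ ?_) hβ'
  · exact mul_le_mul_of_nonneg_right (mul_le_mul_of_nonneg_left h1 (by norm_num)) hN0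
  · exact mul_le_mul_of_nonneg_right (mul_le_mul_of_nonneg_left h2 (by norm_num)) (sq_nonneg S)

end Summit.HubbardSuperconductivity.HubbardSuperconductivity.Theorems.EngineV8

end
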